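import Literature.IUT.HodgeArakelov.GaloisPairCyclotomesGaloisSideNatural
import Literature.IUT.HodgeArakelov.GaloisPairCyclotomesThetaSideNatural
import Literature.IUT.HodgeArakelov.GaloisPairCyclotomesThetaSyncThetaSide
import HarnessLib

/-!
# [IUTchII] Cor. 1.11 (b): the residual (C′) at Cor. 1.10's genuine family FOLLOWS from (HGAL) ∧ (HCYC)_levels —
# ONE residual for the `Π`-side of Cor. 1.11 and binder (P3) of Prop. 3.4 (i)

Mochizuki, *Inter-universal Teichmüller theory II*, §1, Cor. 1.11 (b), kurims manuscript (Dec. 2020) p. 49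
[claim: Mochizuki2012, status: disputed] (IUTchII §1 Cor 1.11, kurims p.49); [AbsTopIII] Cor. 1.10 (c) p. 42; [EtTh] Cor. 2.19 (i)
p. 64. abc-iut cell, layer L6, node `IUTchII:Cor1.11`; seat abc-iut-w5-d145 (gen 4), support chain «CW5D145-CONSOLIDATE» piece
P4 (assembly) for GAP-LEDGER **G-w5d145-2** (cf. **G-w5d169-3**, abc-iut-w4-d007's (HGAL) ∧ (HCYC), p434937). PROOF-ONLY, 0 defs.

THE CONSOLIDATION. abc-iut-w5-d145's `EtaleLevels.nonempty_galCorPiXInput_familyLim_iff_compatible` (p432181) says the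
`Π`-side input `GalCorPiXInput A familyLim` of Cor. 1.11 (b) at Cor. 1.10's GENUINE family is inhabited iff (C′): every comparison
`c : μ_Ẑ(Π^tp_{X̲̲}/Δ) ⥲ (l·Δ_Θ)(𝕄_*)` intertwines `μ_Ẑ(quotMap γ)` with `ρ_A(γ)` for every topological automorphism `γ`. THIS FILE
proves, for a topological automorphism `γ` of `Π^tp_{X̲̲}` and `τ ∈ G_{ℚ_p}`:

* `EtaleLevels.compatible_of_galois` — **(HGAL)** `aug(γ x) = τ·aug(x)·τ⁻¹` ∧ **(HCYC)_levels** `γ̄_{μ,n} = galMuN τ` (all `n`;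
  `γ̄_{μ,n} = coeffAut (levelRigid … n) (h218i n) γ`, [EtTh] Cor. 2.18 (i) at every level BY NAME) ⟹ (C′) AT `γ`, for EVERY `c`.
  Proof: with `F` of `exists_galCyclotome_basePointLim_natural` (P2b: `u₁(γ) = χ_cyc(τ)`) and `t` of `exists_thetaSide_natural`
  (P3: `u₂(γ)` is read off the `γ̄_{μ,n}`, `= χ_cyc(τ)` under (HCYC)), the comparison `c₀ := F ≫ t⁻¹` satisfies (C′) at `γ`
  coordinatewise in `Λ(ℚ̄_pˣ)`; any other `c` differs from `c₀` by an automorphism of `(l·Δ_Θ)(𝕄_*) ≅ Ẑ`, which commutes with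
  `ρ_A(γ)` (`ZHat.mulEquiv_apply_comm_of_mulEquiv`);
* `EtaleLevels.nonempty_galCorPiXInput_familyLim_of_galois` — **«∀ γ ∃ τ, (HGAL) ∧ (HCYC)_levels» ⟹ `GalCorPiXInput A familyLim`
  is inhabited**: the typed residual G-w5d145-2 of node IUTchII:Cor1.11 is DISCHARGED FROM the residual of node IUTchII:Prop3.4(i)
  (P3) (G-w5d169-3, (HGAL) ∧ (HCYC)) — ONE missing functoriality for both: [AbsTopIII] Cor. 1.10 (Galois side: `γ` lies over
  `Inn(τ)|_{G_K}`) and [EtTh] Cor. 2.19 / [IUTchII] Cor. 1.11 (b) (cyclotomic side: levelwise naturality of `thetaMod_n` under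
  `(γ, τ)`, cf. `coeffAut_eq_galMuN_of_thetaMod_natural`), both THEOREMS on `Inn(Π^tp_{X̲̲})` (abc-iut-w4-d007 `hgal_of_inner`;
  abc-iut-w5-d145 `compatible_conj`).
No new `Prop` fact; nothing of another seat restated; nothing here bears on [IUTchIII] Cor. 3.12; typed ≠ discharged.
-/

noncomputable section

namespace Literature.IUT.HodgeArakelov

open CategoryTheory
open Literature.AnabelianGeometry.AbsoluteAnabelian

namespace EtaleLevels

open Literature.AnabelianGeometry.EtaleTheta Literature.AnabelianGeometry.SemiGraphs
open scoped Literature.AnabelianGeometry.EtaleTheta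

variable {p : ℕ} [Fact p.Prime] {D : Literature.AnabelianGeometry.EtaleTheta.ThetaSetting p}
  {E : D.EtaleThetaData} {l : ℕ} (C : E.DoubleUnderline l) (hC : D.Compat) (hS : D.Sec2Hyps)
  (hl : l.Prime) (hp2 : p ≠ 2) (hpl : p ≠ l) (hζ : ∃ ζ : D.K, IsPrimitiveRoot ζ (4 * l))
  (mods : ∀ M : ℕ+, D.CyclotomeMod l M)
  (f : contCocycles D.toTheta D.DeltaTheta C.GtpYdduu) (hf : f ∈ C.rootCocycles hC)
  (hmods : ∀ (M M' : ℕ+) (h : (M : ℕ) ∣ (M' : ℕ)) (x : D.lDeltaTheta l),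
    MuN.red p M M' h ((mods M').red x) = (mods M).red x)
  (h15 : Literature.AnabelianGeometry.EtaleTheta.ThetaSetting.Prop15iii E hC) (L : C.CuspLabels)
  (hZ : ∀ M : ℕ+, Nonempty (ModelCyclotomes.lDeltaQuot (C.rigidData (mods M) hC hS h15 L) ≃*
    Literature.IUT.HodgeTheaters.ZHat))
  (h218i : ∀ M : ℕ+, (levelRigid C hC hS mods h15 L M).Cor218_i)
  [CompactSpace (setting C hC hS hl hp2 hpl hζ mods f hf).Gk] (A : AbsTopMonoids (setting C hC hS hl hp2 hpl hζ mods f hf))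

/-- **(HGAL) ∧ (HCYC)_levels at `(γ, τ)` ⟹ (C′) at `γ`, for every comparison `c`** ([IUTchII] Cor. 1.11 (b) at Cor. 1.10's
genuine family): if the topological automorphism `γ` of `Π^tp_{X̲̲}` lies over `Inn(τ)|_{G_K}` and its coefficient automorphisms
are the Galois action of `τ` at every level, then EVERY isomorphism `c : μ_Ẑ(Π^tp_{X̲̲}/Δ) ⥲ (l·Δ_Θ)(𝕄_*)` intertwines
`μ_Ẑ(quotMap γ)` with `ρ_A(γ)`. [claim: Mochizuki2012, status: disputed] (IUTchII §1 Cor 1.11, kurims p.49) -/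
theorem compatible_of_galois
    (γ : basePointLim C hC hS hl hp2 hpl hζ mods f hf hmods h15 L hZ ⟶ basePointLim C hC hS hl hp2 hpl hζ mods f hf hmods h15 L hZ)
    (τ : GQp p)
    (hγ : ∀ x : (basePointLim C hC hS hl hp2 hpl hζ mods f hf hmods h15 L hZ).G,
      D.aug (Subtype.val (IsoClass.homIso γ x)) = τ * D.aug (Subtype.val x) * τ⁻¹)
    (hcyc : ∀ (n : ℕ+) (a : MuN p n),
      ModelCyclotomes.coeffAut (S := levelSetting C hC hS hl hp2 hpl hζ mods f hf n) (levelRigid C hC hS mods h15 L n)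
        (h218i n) (IsoClass.homIso γ) a = galMuN p n τ a)
    (c : ↥(A.quotObj (basePointLim C hC hS hl hp2 hpl hζ mods f hf hmods h15 L hZ)).galCyclotome ≃*
      (baseDatumLim C hC hS hl hp2 hpl hζ mods f hf hmods h15 L hZ (h218i 1)).A)
    (ζ : (A.quotObj (basePointLim C hC hS hl hp2 hpl hζ mods f hf hmods h15 L hZ)).galCyclotome) :
    c (IsoClass.galCyclotomeMap (A.quotMap γ) ζ) =
      (baseDatumLim C hC hS hl hp2 hpl hζ mods f hf hmods h15 L hZ (h218i 1)).rhoA (IsoClass.homIso γ) (c ζ) := by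
  obtain ⟨F, -, hF⟩ := exists_galCyclotome_basePointLim_natural C hC hS hl hp2 hpl hζ mods f hf hmods h15 L hZ A
  obtain ⟨t, -, ht⟩ := exists_thetaSide_natural C hC hS hl hp2 hpl hζ mods f hf hmods h15 L hZ h218i
  -- the comparison `c₀ := F ≫ t⁻¹` is compatible at `γ`: both sides have `n`-th coordinate `τ (F ζ)_n` after `t`
  set c₀ : ↥(A.quotObj (basePointLim C hC hS hl hp2 hpl hζ mods f hf hmods h15 L hZ)).galCyclotome ≃*
      (baseDatumLim C hC hS hl hp2 hpl hζ mods f hf hmods h15 L hZ (h218i 1)).A := F.trans t.symm with hc₀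
  have key : c₀ (IsoClass.galCyclotomeMap (A.quotMap γ) ζ) =
      (baseDatumLim C hC hS hl hp2 hpl hζ mods f hf hmods h15 L hZ (h218i 1)).rhoA (IsoClass.homIso γ) (c₀ ζ) := by
    apply t.injective
    refine Subtype.ext (funext fun n => Units.ext ?_)
    have h1 : t (c₀ (IsoClass.galCyclotomeMap (A.quotMap γ) ζ)) = F (IsoClass.galCyclotomeMap (A.quotMap γ) ζ) := by
      rw [hc₀, MulEquiv.trans_apply, MulEquiv.apply_symm_apply]
    have h2 : t (c₀ ζ) = F ζ := by
      rw [hc₀, MulEquiv.trans_apply, MulEquiv.apply_symm_apply]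
    have h3 := thetaSide_natural_of_hcyc C hC hS hl hp2 hpl hζ mods f hf hmods h15 L hZ h218i t (IsoClass.homIso γ)
      (ht (IsoClass.homIso γ)) τ hcyc (c₀ ζ) n
    rw [h2] at h3
    rw [h1, hF γ τ hγ ζ n]
    exact h3.symm
  -- any other comparison differs from `c₀` by an automorphism of `(l·Δ_Θ)(𝕄_*) ≅ Ẑ`, which commutes with `ρ_A(γ)`
  obtain ⟨e⟩ := nonempty_baseDatumLim_A_mulEquiv_zHat C hC hS hl hp2 hpl hζ mods f hf hmods h15 L hZ (h218i 1)
  have hδ : ∀ ξ, c ξ = (c₀.symm.trans c) (c₀ ξ) := fun ξ => by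
    rw [MulEquiv.trans_apply, MulEquiv.symm_apply_apply]
  rw [hδ, key, hδ ζ]
  exact Literature.IUT.HodgeTheaters.ZHat.mulEquiv_apply_comm_of_mulEquiv e (c₀.symm.trans c)
    ((baseDatumLim C hC hS hl hp2 hpl hζ mods f hf hmods h15 L hZ (h218i 1)).rhoA (IsoClass.homIso γ)) (c₀ ζ)

/-- **«∀ γ ∃ τ, (HGAL) ∧ (HCYC)_levels» ⟹ the `Π`-side input of [IUTchII] Cor. 1.11 (b) at Cor. 1.10's genuine family is
INHABITED** — for every Ex. 1.8 interface `A`: the residual G-w5d145-2 (node IUTchII:Cor1.11) is discharged from the residual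
(HGAL) ∧ (HCYC) of node IUTchII:Prop3.4(i) (P3) (G-w5d169-3). ONE missing functoriality for both nodes.
[claim: Mochizuki2012, status: disputed] (IUTchII §1 Cor 1.11, kurims p.49) -/
theorem nonempty_galCorPiXInput_familyLim_of_galois
    (hgal : ∀ γ : basePointLim C hC hS hl hp2 hpl hζ mods f hf hmods h15 L hZ ⟶ basePointLim C hC hS hl hp2 hpl hζ mods f hf hmods h15 L hZ,
      ∃ τ : GQp p,
        (∀ x : (basePointLim C hC hS hl hp2 hpl hζ mods f hf hmods h15 L hZ).G,
          D.aug (Subtype.val (IsoClass.homIso γ x)) = τ * D.aug (Subtype.val x) * τ⁻¹) ∧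
        ∀ (n : ℕ+) (a : MuN p n),
          ModelCyclotomes.coeffAut (S := levelSetting C hC hS hl hp2 hpl hζ mods f hf n) (levelRigid C hC hS mods h15 L n)
            (h218i n) (IsoClass.homIso γ) a = galMuN p n τ a) :
    Nonempty (GalCorPiXInput A (familyLim C hC hS hl hp2 hpl hζ mods f hf hmods h15 L hZ (h218i 1))) := by
  rw [nonempty_galCorPiXInput_familyLim_iff_compatible C hC hS hl hp2 hpl hζ mods f hf hmods h15 L hZ (h218i 1) A]
  intro c γ ζ
  obtain ⟨τ, hγ, hcyc⟩ := hgal γ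
  exact compatible_of_galois C hC hS hl hp2 hpl hζ mods f hf hmods h15 L hZ h218i A γ τ hγ hcyc c ζ

/-- The same with (HCYC) in its `thetaMod` form: «`thetaMod_n (γ g) = τ (thetaMod_n g)` for all `n`, `g ∈ φ⁻¹(l·Δ_Θ)`»
(levelwise naturality of the [EtTh] cyclotomic rigidity identifications under `(γ, τ)`).
[claim: Mochizuki2012, status: disputed] (IUTchII §1 Cor 1.11, kurims p.49) -/
theorem nonempty_galCorPiXInput_familyLim_of_thetaMod_natural
    (hgal : ∀ γ : basePointLim C hC hS hl hp2 hpl hζ mods f hf hmods h15 L hZ ⟶ basePointLim C hC hS hl hp2 hpl hζ mods f hf hmods h15 L hZ,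
      ∃ τ : GQp p,
        (∀ x : (basePointLim C hC hS hl hp2 hpl hζ mods f hf hmods h15 L hZ).G,
          D.aug (Subtype.val (IsoClass.homIso γ x)) = τ * D.aug (Subtype.val x) * τ⁻¹) ∧
        ∀ (n : ℕ+) (g : ↥(levelRigid C hC hS mods h15 L n).lDeltaTheta)
          (hg : IsoClass.homIso γ (g : (levelRigid C hC hS mods h15 L n).PiX) ∈ (levelRigid C hC hS mods h15 L n).lDeltaTheta),
          (levelRigid C hC hS mods h15 L n).thetaMod ⟨IsoClass.homIso γ (g : (levelRigid C hC hS mods h15 L n).PiX), hg⟩ =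
            galMuN p n τ ((levelRigid C hC hS mods h15 L n).thetaMod g)) :
    Nonempty (GalCorPiXInput A (familyLim C hC hS hl hp2 hpl hζ mods f hf hmods h15 L hZ (h218i 1))) := by
  refine nonempty_galCorPiXInput_familyLim_of_galois C hC hS hl hp2 hpl hζ mods f hf hmods h15 L hZ h218i A fun γ => ?_
  obtain ⟨τ, hγ, hnat⟩ := hgal γ
  exact ⟨τ, hγ, fun n a => coeffAut_eq_galMuN_of_thetaMod_natural C hC hS hl hp2 hpl hζ mods f hf h15 L h218i n
    (IsoClass.homIso γ) τ (hnat n) a⟩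

end EtaleLevels

end Literature.IUT.HodgeArakelov

end

-- tree-health (abc-iut-w6-d081 g4, 2026-08-26T12:54Z): comment-only re-land of a STRANDED ACCEPT (module accepted, not importable on the farm for > 90 min);
-- declarations byte-identical to the accepted version; purpose = trigger the rebuild (w4-d014 10:34:09Z remedy class). No content change.
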